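import Summits.QuantumFields.YangMills.Theorems.BalabanLadderNTMirrorHankelMirrorForm
import Summits.QuantumFields.YangMills.Theorems.BalabanLadderNTMarkovMirrorChiralFloor
import HarnessLib

/-!
# Crux `NT` (stmt-QuantumFields-19353): the clause-(i) floor `ε ≤ Q2(θv, v)` FORCES the mirror floor — and caps the
# lattice mass

Helper file (`--supports stmt-QuantumFields-19353`) of the fleet lead prover of crux `NT` (unit `ym-spine-19353-p1`,
g10), hypothesis-free; the mirror-Hankel series read in the crux's OWN letters (`Q2 G r β L a (thetaTest 4 v) v`, the
object of `LowerBounds` clause (i) / `RefPkgT` clause 4 / `stub_floorsEngine` conjunct 2).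

The seam proves «(MF) ⇒ clause (i)» modulo a one-point boundary law (RBLΔ ⇐ BL6; `MarkovMirrorChiralFloor`,
`MarkovMirrorBare`).  The CONVERSE needs nothing: by the tree's exact chirality identity
`MarkovMirror.Q2_thetaTest_eq_torusCov_reflSmear` (`Q2(θv, v) = Cov_T(Wᴿ∘Θ₀, Ṽ)`, `Wᴿ` the reflected-species smearing,
`Ṽ` the cube smearing of the action density) and reflection-positivity Cauchy–Schwarz with a bounded witness
(`ConjugateResponse.sq_le_sq_mul_mirrorCov_of_response`),

* **`mirrorFloor_of_Q2_floor`** — `ε ≤ Q2 G r β L s (θv) v` (`0 ≤ ε`) ⇒ `ε² ≤ K_R² · mirrorForm G r β L Ṽ Ṽ` on the same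
  torus, `K_R = sup |Wᴿ|` — the (MF) currency is NECESSARY for clause (i), unconditionally, with the explicit loss
  `ε ↦ ε²/K_R²`;

and then the cap of `…MirrorHankelMirrorForm` applies to the cube moved to the mirror:

* **`q2Floor_caps_gap`** — at one coupling `β ≥ 0` and spacing `s`: if the lattice support of `v(s·)` sits in a cube
  `(c, b)` at depth `≥ 2` with `0 ≤ c 0`, if `ε ≤ Q2 G r β L s (θv) v` on EVERY torus `L ≥ L₀` (`ε > 0`; the cube inside the
  box), and the base smearing `Ṽ₀` (the same cube moved down by `c 0` to the mirror) clusters in the shape of `GapInUnits`,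
  `latticeConnectedCorr r.ρ β (2L+1) (Ṽ₀∘Θ₀) Ṽ₀ n ≤ C e^{−μ n}` (`L ≥ L₀`, `n ≤ L`, `C > 0`), then
  **`μ · 2(c 0) ≤ log (K₀² K_R² / ε²)`** (`K₀ = sup|Ṽ₀|`).

Reading (owner's / LEAD's pen, nothing registered): `c 0 ≈ δ/a(β)` for `supp v ⊆ {y₀ ≥ δ}`, `K₀, K_R ≲ 6N Σ_y|v(a(β)y)| ≍ a(β)⁻⁴`;
a clause-(i) witness therefore forces the LATTICE correlation length of its own smeared density to satisfy
`ξ_lat(β) = 1/μ(β) ≥ 2δ / (a(β) · (16 log(1/a(β)) + 2 log(C_v/ε)))` — «a non-trivial two-point floor in the unit a(β) needs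
ξ_lat ≳ 1/(a(β) log(1/a(β)))»: the divergence of the lattice correlation length along any NT witness, quantified, with a
logarithmic loss against the heuristic `ξ_lat ≍ 1/a(β)`.

Refs: K. Osterwalder, E. Seiler, Ann. Phys. 110 (1978) 440, §2; J. Fröhlich, R. Israel, E. Lieb, B. Simon, CMP 62
(1978) 1, Thm 2.1; J. Glimm, A. Jaffe, *Quantum Physics* (1987) §6.1.
-/

set_option autoImplicit false

noncomputable section

open scoped SchwartzMap
open MeasureTheory Finset
open Literature.MathematicalPhysics.QuantumFieldTheory Literature.MathematicalPhysics.QuantumLattice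
open Literature.Probability.LatticeModels
open Summit.QuantumFields.YangMills.Cruxes.OSLegsFromFemtoAndGap.DlrCollarTransfer
open Summit.QuantumFields.YangMills.Cruxes.OSLegsFromFemtoAndGap.DlrCollarTransfer.StubLower (mem_cubeSites_iff)
open Summit.QuantumFields.YangMills.Cruxes.NT.CumulantPolarisation
open Summit.QuantumFields.YangMills.Cruxes.NT.MarkovMirror
  (Q2_thetaTest_eq_torusCov_reflSmear continuous_reflSmear exists_isCylinder_reflSmear continuous_cubeSmear
    exists_abs_cubeSmear_le exists_isCylinder_cubeSmear)
open Summit.QuantumFields.YangMills.Cruxes.NT.ConjugateResponse (torusE_comp_cfgReflect sq_le_sq_mul_mirrorCov_of_response)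

namespace Summit.QuantumFields.YangMills.Cruxes.NT.MirrorHankel

variable (G : Type) [Group G] [TopologicalSpace G] [IsTopologicalGroup G] [CompactSpace G]
  [MeasurableSpace G] [BorelSpace G] (r : LatticeRep G)

/-! ## §1 Clause (i) forces the mirror floor -/

/-- **`ε ≤ Q2(θv, v)` ⇒ `ε² ≤ K_R² · Cov_T(Ṽ∘Θ₀, Ṽ)`.**  On the torus `2L+1` (`L ≥ 1`, `β ≥ 0`), at spacing `s`, let the
lattice support of `v(s·)` lie in a cube `(c, b)` at depth `≥ 2`, with `0 ≤ c 0`, `c 0 + b + 1 ≤ L`, the cube inside the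
box; let `K_R` bound the reflected-species smearing `Wᴿ = reflSmear c b (v(s·))`.  Then a floor `ε ≤ Q2 G r β L s (θv) v`
(`0 ≤ ε`) forces `ε² ≤ K_R² · mirrorForm G r β L Ṽ Ṽ`, `Ṽ = cubeSmear c b (v(s·))`.
[cite: FrohlichIsraelLiebSimon1978, Thm. 2.1] -/
theorem mirrorFloor_of_Q2_floor {β : ℝ} (hβ : 0 ≤ β) (L : ℕ) (hL : 1 ≤ L) (s : ℝ)
    (v : 𝓢(EuclideanSpace ℝ (Fin 4), ℝ)) (c : Fin 4 → ℤ) (b : ℕ) (hc0 : 0 ≤ c 0) (hcL : c 0 + b + 1 ≤ (L : ℤ))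
    (hsub : cubeSites c b ⊆ box 4 L)
    (hsupp : ∀ y : Fin 4 → ℤ, v (s • siteToE y) ≠ 0 → y ∈ cubeSites c b ∧ 2 ≤ depth c b y)
    {KR : ℝ} (hKR : ∀ V, |reflSmear G r c b (fun x => v (s • siteToE x)) V| ≤ KR)
    {ε : ℝ} (hε : 0 ≤ ε) (hfloor : ε ≤ Q2 G r β L s (thetaTest 4 v) v) :
    ε ^ 2 ≤ KR ^ 2 * mirrorForm G r β L (cubeSmear G r c b (fun y => v (s • siteToE y)))
      (cubeSmear G r c b (fun y => v (s • siteToE y))) := by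
  -- the exact chirality identity `Q2(θv, v) = Cov_T(Wᴿ∘Θ₀, Ṽ)`
  rw [Q2_thetaTest_eq_torusCov_reflSmear G r β L s v c b hsub (fun y hy => (hsupp y hy).1)] at hfloor
  change ε ≤ torusE G r β L (fun V => reflSmear G r c b (fun x => v (s • siteToE x)) (cfgReflect V) *
      cubeSmear G r c b (fun y => v (s • siteToE y)) V) -
    torusE G r β L (fun V => reflSmear G r c b (fun x => v (s • siteToE x)) (cfgReflect V)) *
      torusE G r β L (cubeSmear G r c b (fun y => v (s • siteToE y))) at hfloor
  set W := reflSmear G r c b (fun x => v (s • siteToE x)) with hW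
  set F := cubeSmear G r c b (fun y => v (s • siteToE y)) with hF
  -- symmetry of the mirror pairing: `Cov_T(W∘Θ₀, F) = Cov_T(F∘Θ₀, W)`
  have hsym : torusE G r β L (fun V => W (cfgReflect V) * F V) = torusE G r β L (fun V => F (cfgReflect V) * W V) := by
    rw [← torusE_comp_cfgReflect G r β L (fun V => F (cfgReflect V) * W V)]
    simp only [cfgReflect_cfgReflect, mul_comm]
  rw [hsym, torusE_comp_cfgReflect, mul_comm (torusE G r β L W)] at hfloor
  -- regularity of the two cylinders
  have hFc : Continuous F := continuous_cubeSmear G r c b _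
  obtain ⟨MF, hMF⟩ := exists_abs_cubeSmear_le G r c b (fun y => v (s • siteToE y))
  obtain ⟨SF, hFS, hSF⟩ := exists_isCylinder_cubeSmear G r c b (fun y => v (s • siteToE y))
  have hWc : Continuous W := continuous_reflSmear G r _ _
  obtain ⟨SW, hWS, hSW⟩ := exists_isCylinder_reflSmear G r c b (fun x => v (s • siteToE x))
    (fun x _ hx => (hsupp x hx).2)
  have hwinF : ∀ e ∈ SF, 0 ≤ e.1 0 ∧ e.1 0 + 1 ≤ (L : ℤ) := fun e he => by
    have h := hSF e he 0; constructor <;> linarith [h.1, h.2]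
  have hwinW : ∀ e ∈ SW, 0 ≤ e.1 0 ∧ e.1 0 + 1 ≤ (L : ℤ) := fun e he => by
    have h := hSW e he 0; constructor <;> linarith [h.1, h.2]
  have key := sq_le_sq_mul_mirrorCov_of_response G r hβ L hL hFc hMF hFS hwinF hWc hKR hWS hwinW hε hfloor
  unfold mirrorForm
  exact key

/-! ## §2 Clause (i) on all large tori caps the lattice mass -/

variable {G} {r}

/-- **`ε ≤ Q2(θv, v)` on all large tori × clustering of the base smearing ⇒ `μ · 2(c 0) ≤ log(K₀²K_R²/ε²)`.**  At one
coupling `β ≥ 0` and spacing `s`: the lattice support of `v(s·)` in a cube `(c, b)` at depth `≥ 2` with `0 ≤ c 0`; the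
cube in the box and `c 0 + b + 1 ≤ L` for `L ≥ L₀`; `K_R > 0` bounds `Wᴿ`; `Ṽ₀ := cubeSmear (c − (c 0)e₀) b (v(s·(· + (c 0)e₀)))`
(the smearing moved to the mirror) is bounded by `K₀ > 0`.  If `ε ≤ Q2 G r β L s (θv) v` for all `L ≥ L₀` (`ε > 0`) and
`latticeConnectedCorr r.ρ β (2L+1) (Ṽ₀∘Θ₀) Ṽ₀ n ≤ C·e^{−μ n}` for `L ≥ L₀`, `n ≤ L` (`C > 0`), then
`μ · 2(c 0) ≤ log (K₀² / (ε²/K_R²))`. [cite: GlimmJaffe1987, §6.1] -/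
theorem q2Floor_caps_gap {β : ℝ} (hβ : 0 ≤ β) (s : ℝ) (v : 𝓢(EuclideanSpace ℝ (Fin 4), ℝ))
    (c : Fin 4 → ℤ) (b : ℕ) (hc0 : 0 ≤ c 0)
    (hsupp : ∀ y : Fin 4 → ℤ, v (s • siteToE y) ≠ 0 → y ∈ cubeSites c b ∧ 2 ≤ depth c b y)
    {KR : ℝ} (hKRpos : 0 < KR) (hKR : ∀ V, |reflSmear G r c b (fun x => v (s • siteToE x)) V| ≤ KR)
    {K₀ : ℝ} (hK₀pos : 0 < K₀)
    (hK₀ : ∀ V, |cubeSmear G r (c - Pi.single 0 (c 0)) b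
      (fun y => v (s • siteToE (y + Pi.single 0 (c 0)))) V| ≤ K₀)
    {L₀ : ℕ} (hL₀ : c 0 + b + 1 ≤ (L₀ : ℤ)) (hsub : ∀ L : ℕ, L₀ ≤ L → cubeSites c b ⊆ box 4 L)
    {ε : ℝ} (hε : 0 < ε) (hfloor : ∀ L : ℕ, L₀ ≤ L → ε ≤ Q2 G r β L s (thetaTest 4 v) v)
    {C μ : ℝ} (hC : 0 < C)
    (hgap : ∀ L : ℕ, L₀ ≤ L → ∀ n : ℕ, n ≤ L →
      latticeConnectedCorr r.ρ β (2 * L + 1)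
          (fun V => cubeSmear G r (c - Pi.single 0 (c 0)) b (fun y => v (s • siteToE (y + Pi.single 0 (c 0))))
            (cfgReflect V))
          (cubeSmear G r (c - Pi.single 0 (c 0)) b (fun y => v (s • siteToE (y + Pi.single 0 (c 0))))) n ≤
        C * Real.exp (-(μ * n))) :
    μ * (2 * (c 0).toNat : ℕ) ≤ Real.log (K₀ ^ 2 / (ε ^ 2 / KR ^ 2)) := by
  haveI := r.secondCountableTopology
  set c₀ : Fin 4 → ℤ := c - Pi.single 0 (c 0) with hc₀
  set w₀ : (Fin 4 → ℤ) → ℝ := fun y => v (s • siteToE (y + Pi.single 0 (c 0))) with hw₀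
  have hc₀0 : 0 ≤ c₀ 0 := by simp [hc₀]
  have hcast : ((c 0).toNat : ℤ) = c 0 := Int.toNat_of_nonneg hc0
  -- the translated base cube is the original cube, with the original weights
  have hcube : c₀ + Pi.single 0 (((c 0).toNat : ℕ) : ℤ) = c := by
    rw [hcast, hc₀, sub_add_cancel]
  have hweights : (fun y => w₀ (y - Pi.single 0 (((c 0).toNat : ℕ) : ℤ))) = fun y => v (s • siteToE y) := by
    funext y; rw [hcast, hw₀]; simp only [sub_add_cancel]
  -- regularity of the base smearing
  have hWm : Measurable (cubeSmear G r c₀ b w₀) := (continuous_cubeSmear' G r c₀ b w₀).measurable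
  obtain ⟨SW, hWS, hSW⟩ := exists_isCylinder_cubeSmear G r c₀ b w₀
  have hX : 0 < ε ^ 2 / KR ^ 2 := div_pos (pow_pos hε 2) (pow_pos hKRpos 2)
  refine mirrorFloor_cubeSmear_caps_gap (r := r) hβ hc₀0 hWm hK₀pos hK₀ hWS hSW hX hC (fun L hL => ?_) hgap
  -- the (MF) floor of the translated cube from the clause-(i) floor
  rw [hcube, hweights]
  have hL1 : 1 ≤ L := by
    have : (1 : ℤ) ≤ L₀ := by linarith [hc0]
    omega
  have h := mirrorFloor_of_Q2_floor G r hβ L hL1 s v c b hc0 (by linarith [(Int.ofNat_le.mpr hL : (L₀ : ℤ) ≤ L)])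
    (hsub L hL) hsupp hKR hε.le (hfloor L hL)
  rw [div_le_iff₀ (pow_pos hKRpos 2), mul_comm]
  exact h

end Summit.QuantumFields.YangMills.Cruxes.NT.MirrorHankel

end
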